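import Mathlib
import Summits.KontsevichZagierPeriods.Statement
import Summits.KontsevichZagierPeriods.KontsevichZagierPeriods.Theses.SymplecticScissors
import Literature.NumberTheory.Transcendental.SemialgebraicCubicalChain

/-!
# Sketch — crux-ideate stmt-KontsevichZagierPeriods-9847 (PlanarK0Injective), ideator 1, round 1

Idea `kernel-subgroup-homotopy`: Wüstholz's analytic subgroup theorem in annihilator form
(HW2022 Thm 6.2) on a product of generalised Jacobians ⇒ the vanishing signed area is ONE period
`ω''(u) = 0`, the path is homotopic (rel end points, inside the REAL group) to a path in the
obstruction subgroup `H(ℝ)⁰` on which `ω''` vanishes identically; the planar compiler is then only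
"Stokes on a Nash square is a planar set-chain" (`SquareStokesPlanar`, the First lemma).
-/

noncomputable section

open Set MeasureTheory
open Literature.ModelTheory.ExponentialFields (IsSemialgebraic)
open Literature.NumberTheory.Transcendental

namespace Summit.KontsevichZagierPeriods.KontsevichZagierPeriods.Theses.SymplecticScissors.Sketch9847i1

/-- The planar set-chain group of the crux (verbatim the closure expression of `PlanarK0Injective`). -/
def planarGroup : AddSubgroup KZ.FormalRep :=
  AddSubgroup.closure ((KZ.domainAddRel ∪ KZ.changeOfVariablesRel) ∩
    (AddSubgroup.closure {x : KZ.FormalRep | ∃ s : KZ.IntegralRep 2,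
      (∀ p ∈ s.domain, s.integrand p = 1) ∧ x = KZ.of s} : Set KZ.FormalRep))

/-- The positive subgraph cell `{0 < t < 1, 0 < y < g t}` of a density `g` on the unit interval. -/
def posCell (g : ℝ → ℝ) : Set (Fin 2 → ℝ) := {p | p 0 ∈ Ioo (0:ℝ) 1 ∧ 0 < p 1 ∧ p 1 < g (p 0)}

/-- The negative subgraph cell `{0 < t < 1, 0 < y < -g t}`. -/
def negCell (g : ℝ → ℝ) : Set (Fin 2 → ℝ) := {p | p 0 ∈ Ioo (0:ℝ) 1 ∧ 0 < p 1 ∧ p 1 < - g (p 0)}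

/-- The pulled-back density `t ↦ ⟨P(c t), c′(t)⟩` of the 1-form `Σᵢ Pᵢ dxᵢ` along a 1-cube `c`. -/
def edgeDensity {N : ℕ} (P : (Fin N → ℝ) → (Fin N → ℝ)) (c : NashCubeMap 1 N) : ℝ → ℝ :=
  fun t => ∑ i, P (c fun _ => t) i * fderiv ℝ (fun z => c z) (fun _ => t) (Pi.single 0 1) i

/-- **First lemma of the line (`SquareStokesPlanar`, HW-free).** Stokes for a closed
`ℚ`-semialgebraic `C¹` 1-form `Σ Pᵢ dxᵢ` on an open semialgebraic `S ⊆ ℝᴺ` along a smooth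
`ℚ`-semialgebraic singular square `h : [0,1]² → S` is a PLANAR SET-CHAIN: the signed sum over the
four edges of (positive cell − negative cell) of the edge densities lies in the planar set-chain
group (sign of the edge `(k, ε)` = `(−1)^(k+ε+1)`, the cubical boundary convention of
`SemialgebraicCubicalChain.boundary`). Engine: EqualJacobianTransport on the cells of a sign
subdivision of the square by `∂_b A = ∂_a B` (`h^*(Σ Pᵢdxᵢ) = A da + B db`), Θ-linearity by
StackingShear, vertical cuts, reflections. -/
def SquareStokesPlanar : Prop :=
  ∀ (N : ℕ) (S : Set (Fin N → ℝ)) (P : (Fin N → ℝ) → (Fin N → ℝ)) (h : NashCubeMap 2 N)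
    (U : Set (Fin 2 → ℝ)),
    IsOpen S → IsSemialgebraic ℚ S → IsSemialgebraicMapOn ℚ S P → ContDiffOn ℝ 1 P S →
    (∀ x ∈ S, ∀ i j : Fin N,
      fderiv ℝ P x (Pi.single i 1) j = fderiv ℝ P x (Pi.single j 1) i) →
    MapsTo h (closedUnitCube 2) S → IsOpen U → closedUnitCube 2 ⊆ U →
    (∀ n : ℕ, ContDiffOn ℝ n (fun z => h z) U) →
    ∀ (ρ : Fin 2 → Fin 2 → Bool → KZ.IntegralRep 2),
      (∀ k e b, ∀ p ∈ (ρ k e b).domain, (ρ k e b).integrand p = 1) →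
      (∀ k e, (ρ k e true).domain = posCell (edgeDensity P (h.face k e))) →
      (∀ k e, (ρ k e false).domain = negCell (edgeDensity P (h.face k e))) →
      (∑ k : Fin 2, ∑ e : Fin 2,
        ((-1 : ℤ) ^ (k.val + e.val + 1)) • (KZ.of (ρ k e true) - KZ.of (ρ k e false)))
        ∈ planarGroup

/-- **The transcendence packaging (`VanishingCellsBoundSquares`).** If finitely many NORMALISED
cells (densities `fᵢ` that are `ℚ`-semialgebraic and smooth on a neighbourhood of `[0,1]`, positive on
`(0,1)`) have vanishing signed total area, then there are an open semialgebraic `S ⊆ ℝᴺ`, a closed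
semialgebraic `C¹` 1-form `P` on `S`, finitely many smooth semialgebraic squares `hⱼ` into `S` and
integrand-1 representations `ρ` of their edge cells such that the signed sum of the given cells
equals the total edge sum of the squares MODULO the planar set-chain group. Printed engine:
Wüstholz's analytic subgroup theorem in the annihilator form HW2022 Thm 6.2 on
`G'' = Πᵢ J_𝔪ᵢ(Cᵢ)` (Serre GACC V §10 Prop. 5: `Ω(−𝔪) =` invariant forms), `u = I(γ)` (HW Ch. 5),
`ω''(u) = Σ ± ∫fᵢ = 0 ⇒ ω'' ∈ Ann(u) = 𝔥^⊥`, `u ∈ 𝔥_ℂ`; real form: `H` is conjugation-stable by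
uniqueness, the loop `γ·γ₁⁻¹` (`γ₁ ⊂ H(ℝ)⁰`, zero density) is null-homotopic in `G''(ℝ)⁰`, and a
null-homotopy is realised by Nash squares (semialgebraic triangulation + chartwise cones). -/
def VanishingCellsBoundSquares : Prop :=
  ∀ (k : ℕ) (f : Fin k → ℝ → ℝ) (ε : Fin k → Fin 2) (δ : ℚ), 0 < δ →
    (∀ i, IsSemialgebraicFunOn ℚ {z : Fin 1 → ℝ | z 0 ∈ Ioo (-(δ : ℝ)) (1 + δ)} fun z => f i (z 0)) →
    (∀ i, ∀ n : ℕ, ContDiffOn ℝ n (f i) (Ioo (-(δ : ℝ)) (1 + δ))) →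
    (∀ i, ∀ x ∈ Ioo (0 : ℝ) 1, 0 < f i x) →
    ∑ i, (-1 : ℝ) ^ (ε i).val * ∫ x in (0 : ℝ)..1, f i x = 0 →
    ∀ (r : Fin k → KZ.IntegralRep 2), (∀ i, ∀ p ∈ (r i).domain, (r i).integrand p = 1) →
      (∀ i, (r i).domain = posCell (f i)) →
    ∃ (N : ℕ) (S : Set (Fin N → ℝ)) (P : (Fin N → ℝ) → (Fin N → ℝ)) (n : ℕ)
      (h : Fin n → NashCubeMap 2 N) (U : Set (Fin 2 → ℝ))
      (ρ : Fin n → Fin 2 → Fin 2 → Bool → KZ.IntegralRep 2),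
      IsOpen S ∧ IsSemialgebraic ℚ S ∧ IsSemialgebraicMapOn ℚ S P ∧ ContDiffOn ℝ 1 P S ∧
      (∀ x ∈ S, ∀ i j : Fin N,
        fderiv ℝ P x (Pi.single i 1) j = fderiv ℝ P x (Pi.single j 1) i) ∧
      (∀ j, MapsTo (h j) (closedUnitCube 2) S) ∧ IsOpen U ∧ closedUnitCube 2 ⊆ U ∧
      (∀ j, ∀ m : ℕ, ContDiffOn ℝ m (fun z => h j z) U) ∧
      (∀ j k e b, ∀ p ∈ (ρ j k e b).domain, (ρ j k e b).integrand p = 1) ∧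
      (∀ j k e, (ρ j k e true).domain = posCell (edgeDensity P ((h j).face k e))) ∧
      (∀ j k e, (ρ j k e false).domain = negCell (edgeDensity P ((h j).face k e))) ∧
      ((∑ i, ((-1 : ℤ) ^ (ε i).val) • KZ.of (r i)) -
        ∑ j, ∑ k : Fin 2, ∑ e : Fin 2,
          ((-1 : ℤ) ^ (k.val + e.val + 1)) • (KZ.of (ρ j k e true) - KZ.of (ρ j k e false)))
        ∈ planarGroup

/-- **Chain-level packaging (`VanishingCellsNullHomotopy`) — the stub shape a crux-plan should use
for the transcendence step (anti-costume: no planar group occurs in it).** Normalised cells with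
vanishing signed area are, after a rational subdivision `τ` of `[0,1]` and affine reparametrisation,
LITERALLY the non-degenerate boundary edges of a finite sum of smooth semialgebraic squares in an open
semialgebraic `S ⊆ ℝᴺ` carrying a closed semialgebraic `C¹` 1-form `P`, up to edges along which the
density of `P` vanishes identically (the path `γ₁ ⊂ H(ℝ)⁰` given by HW Thm 6.2, constant edges, cone
apices). Construction: `S` = Nash tubular neighbourhood of (a compact piece of) `G''(ℝ)⁰ ⊂ ℝᴺ`,
`P = ρ^*ω''`; grid-subdivide a continuous null-homotopy of `γ·γ₁⁻¹` in `S`, straighten internal grid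
edges to segments, and take the CONE over every grid edge from a point of its face (straight cones in the
convex ball containing the face): internal edges and radial edges cancel literally in the free abelian
group on 1-cubes. -/
def VanishingCellsNullHomotopy : Prop :=
  ∀ (k : ℕ) (f : Fin k → ℝ → ℝ) (ε : Fin k → Fin 2) (δ : ℚ), 0 < δ →
    (∀ i, IsSemialgebraicFunOn ℚ {z : Fin 1 → ℝ | z 0 ∈ Ioo (-(δ : ℝ)) (1 + δ)} fun z => f i (z 0)) →
    (∀ i, ∀ n : ℕ, ContDiffOn ℝ n (f i) (Ioo (-(δ : ℝ)) (1 + δ))) →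
    (∀ i, ∀ x ∈ Ioo (0 : ℝ) 1, 0 < f i x) →
    ∑ i, (-1 : ℝ) ^ (ε i).val * ∫ x in (0 : ℝ)..1, f i x = 0 →
    ∃ (N : ℕ) (S : Set (Fin N → ℝ)) (P : (Fin N → ℝ) → (Fin N → ℝ)) (n : ℕ)
      (h : Fin n → NashCubeMap 2 N) (U : Set (Fin 2 → ℝ))
      (L : Fin k → ℕ) (e : (i : Fin k) → Fin (L i) → NashCubeMap 1 N)
      (τ : (i : Fin k) → Fin (L i + 1) → ℚ)
      (m : ℕ) (z : Fin m → NashCubeMap 1 N) (cz : Fin m → ℤ),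
      IsOpen S ∧ IsSemialgebraic ℚ S ∧ IsSemialgebraicMapOn ℚ S P ∧ ContDiffOn ℝ 1 P S ∧
      (∀ x ∈ S, ∀ i j : Fin N,
        fderiv ℝ P x (Pi.single i 1) j = fderiv ℝ P x (Pi.single j 1) i) ∧
      (∀ j, MapsTo (h j) (closedUnitCube 2) S) ∧ IsOpen U ∧ closedUnitCube 2 ⊆ U ∧
      (∀ j, ∀ q : ℕ, ContDiffOn ℝ q (fun w => h j w) U) ∧
      (∀ i, τ i 0 = 0 ∧ τ i (Fin.last (L i)) = 1 ∧ StrictMono (τ i)) ∧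
      (∀ i l, ∀ s ∈ Icc (0 : ℝ) 1,
        edgeDensity P (e i l) s =
          ((τ i l.succ : ℝ) - τ i l.castSucc) *
            f i (τ i l.castSucc + ((τ i l.succ : ℝ) - τ i l.castSucc) * s)) ∧
      (∀ q, ∀ s ∈ Icc (0 : ℝ) 1, edgeDensity P (z q) s = 0) ∧
      (∑ j, SemialgebraicCubicalChain.boundary (FreeAbelianGroup.of (h j)) =
        (∑ i, ((-1 : ℤ) ^ (ε i).val) • ∑ l, FreeAbelianGroup.of (e i l)) +
          ∑ q, cz q • FreeAbelianGroup.of (z q))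

/-- **Planar bookkeeping (`ChainToPlanar`, provable-now): a chain-level identity as above becomes the
planar-group identity of `VanishingCellsBoundSquares`** — subdivision of a cell at rational points is
1a (+ null cut lines), affine reparametrisation of a piece is one rule-2 shear `(t,y) ↦ (a + (b−a)t,
y/(b−a))`, an edge with identically vanishing density has empty cells (`[∅] ≡ 0`), and
`SquareStokesPlanar` disposes of each square. Recorded informally here; the typed composition is
`planarK0Injective_of`. -/
def ChainToPlanar : Prop := VanishingCellsNullHomotopy → SquareStokesPlanar → VanishingCellsBoundSquares

/-- **Reading (`ReadingNormalForm`, provable-now, route's normalisation).** Two integrand-1 planar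
representations differ, modulo the planar set-chain group, by a signed sum of normalised cells
(cylindrical decomposition 1a, shears `(x, y − g x)`, compactification `(x,u) ↦ (1/x, ux²)`,
desingularisation `x = a + s^q` — all `|det| = 1` or rule-2 shears), and the signed areas add up to
`r.value − r'.value`. -/
def ReadingNormalForm : Prop :=
  ∀ (r r' : KZ.IntegralRep 2), (∀ p ∈ r.domain, r.integrand p = 1) →
    (∀ p ∈ r'.domain, r'.integrand p = 1) →
    ∃ (k : ℕ) (f : Fin k → ℝ → ℝ) (ε : Fin k → Fin 2) (δ : ℚ) (c : Fin k → KZ.IntegralRep 2),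
      0 < δ ∧
      (∀ i, IsSemialgebraicFunOn ℚ {z : Fin 1 → ℝ | z 0 ∈ Ioo (-(δ : ℝ)) (1 + δ)} fun z => f i (z 0)) ∧
      (∀ i, ∀ n : ℕ, ContDiffOn ℝ n (f i) (Ioo (-(δ : ℝ)) (1 + δ))) ∧
      (∀ i, ∀ x ∈ Ioo (0 : ℝ) 1, 0 < f i x) ∧
      (∀ i, ∀ p ∈ (c i).domain, (c i).integrand p = 1) ∧
      (∀ i, (c i).domain = posCell (f i)) ∧
      (∑ i, (-1 : ℝ) ^ (ε i).val * ∫ x in (0 : ℝ)..1, f i x) = r.value - r'.value ∧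
      (KZ.of r - KZ.of r') - ∑ i, ((-1 : ℤ) ^ (ε i).val) • KZ.of (c i) ∈ planarGroup

/-- The line concludes the crux BY NAME: reading + packaging + square-Stokes ⇒ `PlanarK0Injective`. -/
theorem planarK0Injective_of (hR : ReadingNormalForm) (hV : VanishingCellsBoundSquares)
    (hS : SquareStokesPlanar) : PlanarK0Injective := by
  intro r r' hr hr' hval
  obtain ⟨k, f, ε, δ, c, hδ, hsa, hsm, hpos, hc1, hcdom, hsum, hmem⟩ := hR r r' hr hr'
  have hzero : ∑ i, (-1 : ℝ) ^ (ε i).val * ∫ x in (0 : ℝ)..1, f i x = 0 := by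
    rw [hsum, hval, sub_self]
  obtain ⟨N, S, P, n, h, U, ρ, hSo, hSsa, hP, hP1, hclosed, hmaps, hUo, hUsub, hsmooth, hρ1,
    hρpos, hρneg, hdiff⟩ := hV k f ε δ hδ hsa hsm hpos hzero c hc1 hcdom
  have hsq : ∀ j, (∑ k : Fin 2, ∑ e : Fin 2,
      ((-1 : ℤ) ^ (k.val + e.val + 1)) • (KZ.of (ρ j k e true) - KZ.of (ρ j k e false)))
      ∈ planarGroup :=
    fun j => hS N S P (h j) U hSo hSsa hP hP1 hclosed (hmaps j) hUo hUsub (hsmooth j) (ρ j)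
      (hρ1 j) (hρpos j) (hρneg j)
  have hsqsum : (∑ j, ∑ k : Fin 2, ∑ e : Fin 2,
      ((-1 : ℤ) ^ (k.val + e.val + 1)) • (KZ.of (ρ j k e true) - KZ.of (ρ j k e false)))
      ∈ planarGroup := AddSubgroup.sum_mem _ fun j _ => hsq j
  have hcells : (∑ i, ((-1 : ℤ) ^ (ε i).val) • KZ.of (c i)) ∈ planarGroup := by
    have := planarGroup.add_mem hdiff hsqsum
    simpa using this
  have := planarGroup.add_mem hmem hcells
  simpa [planarGroup] using this

end Summit.KontsevichZagierPeriods.KontsevichZagierPeriods.Theses.SymplecticScissors.Sketch9847i1
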